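import Literature.AnabelianGeometry.EtaleTheta.Discharge.Sec4Remark411OfConnectedTemperoid
import Literature.AnabelianGeometry.EtaleTheta.TemperedFrobenioidOfDiagonalBase
import Literature.AnabelianGeometry.EtaleTheta.RealificationPfImageWeak
import Literature.AlgebraicGeometry.Frobenioids.MonoidFunctorsOnD
import Literature.AlgebraicGeometry.Frobenioids.FrobeniusTypePerfect

/-!
# [EtTh] Remark 4.1.1 — descent engines for the genuine towers: deck-transitivity out of Galois objects of `B^temp(Π)`,
# and Galois descent of `Φ = im(Φ₀^pf → Φ₀^rlf)` / `B = B₀ ×_{(Φ₀^ℝ)^gp} Φ^gp` for the `ofDiagonalBase` tempered Frobenioids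

S. Mochizuki, *The étale theta function …*, Publ. RIMS **45** (2009), Rmk. 4.1.1 p. 88 (PDF) («… by applying Proposition 3.4,
(ii) … one verifies easily that `A → B` is a categorical quotient …») [cite: MochizukiEtTh2009, Rmk 4.1.1 p.88]; *Semi-graphs of
anabelioids*, Publ. RIMS **42** (2006), Rmk. 3.1.3 p. 34 (Galois objects `Π/N`, `Aut = Π/N` by right translations)
[cite: MochizukiSemiAnbd2006, Rmk 3.1.3 p.34]; *Frobenioids I*, Def. 1.1 (ii) p. 19 [cite: MochizukiFrdI2008, Def. 1.1(ii) p.19].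

abc-iut cell, layer L2 [EtTh], L-F row F-0729 (`BiKummerSetting.Remark411`), seat abc-iut-w6-d047 (gen 5), row «RMK411@ZTOWER»,
FILE A (generic engines).  PROOF-ONLY (0 definitions; nothing landed is edited).  abc-iut-f-108's
`remark411_ofConnectedPart_treeCatVocab_of_galoisDescent` (Discharge/Sec4Remark411OfConnectedTemperoid) reduces Remark 4.1.1 over
the genuine base `B^temp(Π^tp_X)⁰` to two descent inputs (Φ) `hΦdesc`, (B) `hBdesc` on the divisor / rational-function monoids
along arrows out of Galois objects.  Here:
* §1 `GaloisObjects.exists_autOver_apply_eq` (+ `connectedPart_…`): an arrow `p` out of a Galois object of `B^temp(Π)` is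
  DECK-TRANSITIVE — points with the same `p`-image are exchanged by an automorphism over `p` (right translation by `g₁⁻¹g₂`);
* §2 for abc-iut-w5-d179's engine `TemperedFrobenioid.ofDiagonalBase hpf P …` (`Φ(A) = im(Φ₀(FA)^pf → Φ₀(FA)^rlf)`):
  `ofDiagonalBase_divisorMonoid_descent_of_Φ₀` — (Φ) for `Φ` follows from descent of deck-invariants in `Φ₀` along `F p`
  (a deck-invariant `ι(m^{1/n})` has `m` invariant because `Φ₀(FA)^pf → Φ₀(FA)^rlf` is injective and `Φ₀(FA)` is divisorial;
  descend `m`, take `ι(m'^{1/n})`); `ofDiagonalBase_pullGp_divisorMonoid_injective` — `Φ(p)^gp` injective (pull-backs of `Φ`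
  injective, `Φ` cancellative);
* §3 `ofDiagonalBase_ratFnFunctor_descent_of_B₀` — (B) for `B = B₀ ×_{(Φ₀^ℝ)^gp} Φ^gp` follows from descent of deck-invariants
  in `B₀` along `F p` (the `Φ^gp`-coordinate of the descended pair is `div₀(b′)` read in `Φ(B₁)^gp`, and it pulls back to the
  given one because `Φ(A₁)^gp → (Φ₀^ℝ)^gp(A₁)` is injective); `ofDiagonalBase_pull_ratFnFunctor_injective` — from injectivity of
  the `B₀`-transition and of `Φ(p)^gp`.
HONEST FRAMING: elementary descent bookkeeping for OUR constructed data; refereed pre-IUT material; nothing here bears on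
[IUTchIII] Cor. 3.12; no side taken; typed ≠ proved.
-/

noncomputable section

open CategoryTheory Opposite Function

/-! ## §1 Deck-transitivity of arrows out of Galois objects of `B^temp(Π)` -/

namespace Literature.AnabelianGeometry.SemiGraphs

namespace GaloisObjects

open Literature.AlgebraicGeometry.Frobenioids (IsConnectedObj ConnectedPart connectedObjects)
open Literature.AlgebraicGeometry.Frobenioids.QuasiTemperoid.BTempConnected

universe u

variable {G : Type u} [Group G] [TopologicalSpace G] [IsTopologicalGroup G]

/-- **Deck-transitivity of an arrow out of a Galois object of `B^temp(Π)`** ([SemiAnbd] Rmk 3.1.3: `A ≅ Π/N_A` with `Π` acting on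
`Aut(A)` through right translations): for `Π` tempered, `A` Galois and ANY arrow `p : A → B`, two points of `A` with the same image
under `p` are exchanged by an automorphism of `A` over `p` (`x_A ↦ (g₁⁻¹g₂)·x_A` if the points are `g₁·x_A`, `g₂·x_A`).
[cite: MochizukiSemiAnbd2006, Rmk 3.1.3 p.34] -/
theorem exists_autOver_apply_eq (hG : IsTempered G) {A B : BTemp G} (hA : IsGaloisObj A) (p : A ⟶ B)
    (s₁ s₂ : A.obj.V) (h : (p.hom.hom s₁ : B.obj.V) = p.hom.hom s₂) :
    ∃ σ : Aut A, σ.hom ≫ p = p ∧ (σ.hom.hom.hom s₁ : A.obj.V) = s₂ := by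
  obtain ⟨g₁, rfl⟩ := exists_ρ_galoisBase_eq hG A hA s₁
  obtain ⟨g₂, rfl⟩ := exists_ρ_galoisBase_eq hG A hA s₂
  refine ⟨galoisSurjOf hG A hA (g₁⁻¹ * g₂)⁻¹, ?_, ?_⟩
  · refine hom_eq_of_apply_eq hA.1 _ _ (galoisBase hG A hA) ?_
    have h' : B.obj.ρ g₁ (p.hom.hom (galoisBase hG A hA)) = B.obj.ρ g₂ (p.hom.hom (galoisBase hG A hA)) := by
      rw [← hom_ρ, ← hom_ρ]; exact h
    rw [comp_apply, galoisSurjOf_apply_base, inv_inv, hom_ρ, ρ_mul_apply, ← h', ρ_inv_apply]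
  · rw [galoisSurjOf_apply, inv_inv, ← mul_assoc, mul_inv_cancel, one_mul]

/-- **The same in the connected temperoid `B^temp(Π)⁰ = ConnectedPart (BTemp Π)`** (the base category of the genuine towers): for
`A` Galois and any arrow `p : A → B` of `B^temp(Π)⁰`, points of `A` with the same `p`-image are exchanged by an automorphism of
`A` over `p` IN `B^temp(Π)⁰`. [cite: MochizukiSemiAnbd2006, Rmk 3.1.3 p.34] -/
theorem connectedPart_exists_autOver_apply_eq (hG : IsTempered G) {A B : ConnectedPart (BTemp G)}
    (hA : IsGaloisObj A.obj) (p : A ⟶ B) (s₁ s₂ : A.obj.obj.V)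
    (h : (p.hom.hom.hom s₁ : B.obj.obj.V) = p.hom.hom.hom s₂) :
    ∃ σ : Aut A, σ.hom ≫ p = p ∧ (σ.hom.hom.hom.hom s₁ : A.obj.obj.V) = s₂ := by
  obtain ⟨σ, hσp, hσs⟩ := exists_autOver_apply_eq hG hA p.hom s₁ s₂ h
  exact ⟨(connectedObjects (BTemp G)).isoMk σ, ObjectProperty.hom_ext _ hσp, hσs⟩

end GaloisObjects

end Literature.AnabelianGeometry.SemiGraphs

/-! ## §2 Galois descent of `Φ = im(Φ₀^pf → Φ₀^rlf)` for the `ofDiagonalBase` engine -/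

namespace Literature.AnabelianGeometry.EtaleTheta

namespace TemperedFrobenioid

open Literature.AlgebraicGeometry.Frobenioids

universe u₀ v₀ u v

section DescentEngine

variable {D₀ : Type u₀} [Category.{v₀} D₀] {dm : DivisorMonoids.{u₀, v₀, 0} D₀}
  (hpf : ∀ Y : D₀ᵒᵖ, IsPerfFactorialCof (dm.Φ₀.obj Y)) {D : Type u} [Category.{v} D] (P : DiagonalBase dm D)
  (hD : IsConnected D) (hD' : IsTotallyEpimorphic D) (hFSM : IsOfFSMType D) (R S : (Dᵒᵖ ⥤ CommMonCat.{0}) → Prop)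

/-- The pull-back of `Φ` along `f` is the weak realification map `Φ₀(F f)^rlf` on underlying elements.
[cite: MochizukiEtTh2009, Def 3.6 p.76] -/
theorem ofDiagonalBase_pull_divisorMonoid_coe {A B : D} (f : B ⟶ A)
    (z : (ofDiagonalBase hpf P hD hD' hFSM R S).divisorMonoid.obj (op A)) :
    (pull (ofDiagonalBase hpf P hD hD' hFSM R S).divisorMonoid f z).1 =
      rlfMapWeak dm.Φ₀ hpf (P.F.map f).op z.1 := rfl

/-- **(Φ) for `Φ = im(Φ₀^pf → Φ₀^rlf)` from descent in `Φ₀`**: if every deck-invariant element of `Φ₀(F A₁)` (decks = automorphisms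
of `A₁` over `p`) descends along `Φ₀(F p)`, then every deck-invariant element of `Φ(A₁)` descends along `Φ(p)` — a deck-invariant
`ι(m^{1/n})` has `m` deck-invariant (`Φ₀^pf → Φ₀^rlf` injective for weakly perf-factorial `Φ₀`, and `Φ₀` divisorial so `n`-th
powers are injective), and `ι(m′^{1/n})` pulls back to it for any `m′ ↦ m`. [cite: MochizukiEtTh2009, Rmk 4.1.1 p.88] -/
theorem ofDiagonalBase_divisorMonoid_descent_of_Φ₀ {A₁ B₁ : D} (p : A₁ ⟶ B₁)
    (hΦ₀ : ∀ m : dm.Φ₀.obj (op (P.F.obj A₁)),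
      (∀ g : Aut A₁, g.hom ≫ p = p → (dm.Φ₀.map (P.F.map g.hom).op).hom m = m) →
        ∃ m' : dm.Φ₀.obj (op (P.F.obj B₁)), (dm.Φ₀.map (P.F.map p).op).hom m' = m)
    (z : (ofDiagonalBase hpf P hD hD' hFSM R S).divisorMonoid.obj (op A₁))
    (hz : ∀ g : Aut A₁, g.hom ≫ p = p →
      pull (ofDiagonalBase hpf P hD hD' hFSM R S).divisorMonoid g.hom z = z) :
    ∃ z' : (ofDiagonalBase hpf P hD hD' hFSM R S).divisorMonoid.obj (op B₁),
      pull (ofDiagonalBase hpf P hD hD' hFSM R S).divisorMonoid p z' = z := by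
  obtain ⟨a, ha⟩ := z.2
  obtain ⟨⟨m, n⟩, rfl⟩ := Perfection.mk_surjective a
  -- `ha : ι(m^{1/n}) = z`
  have ha' : (hpf (op (P.F.obj A₁))).weak.toRealification (Perfection.mk m n) = z.1 := ha
  -- naturality of `ι` on a class `m^{1/n}`
  have hnat : ∀ {A B : D} (f : B ⟶ A) (x : dm.Φ₀.obj (op (P.F.obj A))) (k : ℕ+),
      rlfMapWeak dm.Φ₀ hpf (P.F.map f).op ((hpf (op (P.F.obj A))).weak.toRealification (Perfection.mk x k)) =
        (hpf (op (P.F.obj B))).weak.toRealification (Perfection.mk ((dm.Φ₀.map (P.F.map f).op).hom x) k) := by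
    intro A B f x k
    have h := DFunLike.congr_fun (rlfMapWeak_comp_toRealification dm.Φ₀ hpf (P.F.map f).op) (Perfection.mk x k)
    rw [MonoidHom.comp_apply, MonoidHom.comp_apply, Perfection.map_mk] at h
    exact h
  -- `m` is deck-invariant
  have hm : ∀ g : Aut A₁, g.hom ≫ p = p → (dm.Φ₀.map (P.F.map g.hom).op).hom m = m := by
    intro g hg
    have h1 := congrArg Subtype.val (hz g hg)
    rw [ofDiagonalBase_pull_divisorMonoid_coe, ← ha', hnat] at h1
    have h2 := PfImageWeak.toRealification_injective (hpf (op (P.F.obj A₁))).weak h1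
    obtain ⟨N, hN⟩ := Perfection.mk_eq_mk_iff.mp h2
    exact PreFrobenioid.pow_injective_of_isDivisorial (hpf (op (P.F.obj A₁))).weak.isDivisorial (Nat.mul_pos N.pos n.pos) hN
  obtain ⟨m', hm'⟩ := hΦ₀ m hm
  refine ⟨⟨(hpf (op (P.F.obj B₁))).weak.toRealification (Perfection.mk m' n), ⟨Perfection.mk m' n, rfl⟩⟩,
    Subtype.ext ?_⟩
  rw [ofDiagonalBase_pull_divisorMonoid_coe, ← ha']
  change rlfMapWeak dm.Φ₀ hpf (P.F.map p).op ((hpf (op (P.F.obj B₁))).weak.toRealification (Perfection.mk m' n)) = _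
  rw [hnat, hm']

/-- **`Φ(p)^gp` is injective** for the `ofDiagonalBase` engine: the pull-backs of `Φ` are injective (`Φsub_pull_injective`) and
`Φ` is cancellative (a submonoid of the divisorial `Φ₀^rlf`). [cite: MochizukiFrdI2008, Def. 1.1(ii) p.19] -/
theorem ofDiagonalBase_pullGp_divisorMonoid_injective {A₁ B₁ : D} (p : A₁ ⟶ B₁) :
    Injective (pullGp (ofDiagonalBase hpf P hD hD' hFSM R S).divisorMonoid p) := by
  haveI : IsCancelMul ((ofDiagonalBase hpf P hD hD' hFSM R S).divisorMonoid.obj (op B₁)) := isIntegral_iff_isCancelMul.mp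
    (PfImageWeak.isDivisorial_mrange_toRealification (hpf (op (P.F.obj B₁)))).isPreDivisorial.isIntegral
  haveI : IsCancelMul ((ofDiagonalBase hpf P hD hD' hFSM R S).divisorMonoid.obj (op A₁)) := isIntegral_iff_isCancelMul.mp
    (PfImageWeak.isDivisorial_mrange_toRealification (hpf (op (P.F.obj A₁)))).isPreDivisorial.isIntegral
  exact gpMap_injective _ (P.Φsub_pull_injective hpf p.op)

/-! ## §3 Galois descent of `B = B₀ ×_{(Φ₀^ℝ)^gp} Φ^gp` for the `ofDiagonalBase` engine -/

/-- `Φ₀(F A) → Φ(A)`, `m ↦ ι(m)` (codomain-restricted `Φ₀ → Φ₀^pf → Φ₀^rlf`). [cite: MochizukiEtTh2009, Def 3.6 p.76] -/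
theorem ofDiagonalBase_toR_mem (A : Dᵒᵖ) (m : dm.Φ₀.obj (op (P.F.obj A.unop))) :
    (hpf (op (P.F.obj A.unop))).weak.toRealification (Perfection.of _ m) ∈
      (ofDiagonalBase hpf P hD hD' hFSM R S).Φ.carrier A :=
  ⟨Perfection.of _ m, rfl⟩

/-- The inclusion `Φ(A)^gp → (Φ₀^ℝ)^gp(A)` is injective (`Φ(A) ⊆ Φ₀(FA)^rlf`, both cancellative).
[cite: MochizukiFrdI2008, Def. 1.1(ii) p.19] -/
theorem ofDiagonalBase_ΦgpToRlog_injective (A : Dᵒᵖ) :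
    Injective ((ofDiagonalBase hpf P hD hD' hFSM R S).ΦgpToRlog A) := by
  haveI : IsCancelMul ((ofDiagonalBase hpf P hD hD' hFSM R S).Φ.carrier A) := isIntegral_iff_isCancelMul.mp
    (PfImageWeak.isDivisorial_mrange_toRealification (hpf (op (P.F.obj A.unop)))).isPreDivisorial.isIntegral
  haveI : IsCancelMul ((RealifiedDivisorMonoids.ofRlfZWeak dm hpf).ΦR.obj
      ((ofDiagonalBase hpf P hD hD' hFSM R S).baseOp A)) :=
    IsPerfFactorialWeak.Rlf.isCancelMul (hpf (op (P.F.obj A.unop))).weak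
  exact gpMap_injective _ Subtype.val_injective

/-- **(B) for `B = B₀ ×_{(Φ₀^ℝ)^gp} Φ^gp` from descent in `B₀`**: if every deck-invariant element of `B₀(F A₁)` descends along
`B₀(F p)`, then every deck-invariant rational function `(b, ξ) ∈ B(A₁)` descends along `B(p)`: descend `b` to `b′`, take
`ξ′ := ι(div₀ b′) ∈ Φ(B₁)^gp`; the pair lies in `B(B₁)` by construction and pulls back to `(b, ξ)` because
`Φ(A₁)^gp → (Φ₀^ℝ)^gp(A₁)` is injective and both images equal `Div(b)`. [cite: MochizukiEtTh2009, Rmk 4.1.1 p.88] -/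
theorem ofDiagonalBase_ratFnFunctor_descent_of_B₀ {A₁ B₁ : D} (p : A₁ ⟶ B₁)
    (hB₀ : ∀ b : dm.B₀.obj (op (P.F.obj A₁)),
      (∀ g : Aut A₁, g.hom ≫ p = p → (dm.B₀.map (P.F.map g.hom).op).hom b = b) →
        ∃ b' : dm.B₀.obj (op (P.F.obj B₁)), (dm.B₀.map (P.F.map p).op).hom b' = b)
    (t : (ofDiagonalBase hpf P hD hD' hFSM R S).ratFnFunctor.obj (op A₁))
    (ht : ∀ g : Aut A₁, g.hom ≫ p = p →
      pull (ofDiagonalBase hpf P hD hD' hFSM R S).ratFnFunctor g.hom t = t) :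
    ∃ t' : (ofDiagonalBase hpf P hD hD' hFSM R S).ratFnFunctor.obj (op B₁),
      pull (ofDiagonalBase hpf P hD hD' hFSM R S).ratFnFunctor p t' = t := by
  -- descend the function
  have hb : ∀ g : Aut A₁, g.hom ≫ p = p → (dm.B₀.map (P.F.map g.hom).op).hom t.1.1 = t.1.1 := fun g hg =>
    congrArg (fun u : (ofDiagonalBase hpf P hD hD' hFSM R S).ratFn (op A₁) => u.1.1) (ht g hg)
  obtain ⟨b', hb'⟩ := hB₀ t.1.1 hb
  -- the divisor coordinate of the descended pair: `ι(div₀ b′) ∈ Φ(B₁)^gp`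
  let ι : dm.Φ₀.obj (op (P.F.obj B₁)) →* (ofDiagonalBase hpf P hD hD' hFSM R S).Φ.carrier (op B₁) :=
    ((hpf (op (P.F.obj B₁))).weak.toRealification.comp (Perfection.of _)).codRestrict _
      fun m => ofDiagonalBase_toR_mem hpf P hD hD' hFSM R S (op B₁) m
  have hι : ((ofDiagonalBase hpf P hD hD' hFSM R S).Φ.carrier (op B₁)).subtype.comp ι =
      (hpf (op (P.F.obj B₁))).weak.toRealification.comp (Perfection.of _) := rfl
  let ξ' : Algebra.GrothendieckGroup ((ofDiagonalBase hpf P hD hD' hFSM R S).Φ.carrier (op B₁)) := gpMap ι (dm.div₀ (op (P.F.obj B₁)) b')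
  have hmem : (b', ξ') ∈ (ofDiagonalBase hpf P hD hD' hFSM R S).ratFn (op B₁) := by
    change (RealifiedDivisorMonoids.ofRlfZWeak dm hpf).divΛ (op (P.F.obj B₁)) b' = (ofDiagonalBase hpf P hD hD' hFSM R S).ΦgpToRlog (op B₁) ξ'
    rw [RealifiedDivisorMonoids.ofRlfZWeak_divΛ_apply, toRlfNatTransWeak_app_hom, ← hι]
    exact gpMap_comp_apply'' ι ((ofDiagonalBase hpf P hD hD' hFSM R S).Φ.carrier (op B₁)).subtype _
  refine ⟨⟨(b', ξ'), hmem⟩, Subtype.ext (Prod.ext ?_ ?_)⟩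
  · -- first coordinate: `B₀(F p)(b′) = b`
    exact hb'
  · -- second coordinate, after `Φ(A₁)^gp ↪ (Φ₀^ℝ)^gp(A₁)`
    apply ofDiagonalBase_ΦgpToRlog_injective hpf P hD hD' hFSM R S (op A₁)
    change (ofDiagonalBase hpf P hD hD' hFSM R S).ΦgpToRlog (op A₁) (gpMap ((ofDiagonalBase hpf P hD hD' hFSM R S).Φ.pull p.op) ξ') = (ofDiagonalBase hpf P hD hD' hFSM R S).ΦgpToRlog (op A₁) t.1.2
    rw [(ofDiagonalBase hpf P hD hD' hFSM R S).ΦgpToRlog_pull, ← hmem, ← (RealifiedDivisorMonoids.ofRlfZWeak dm hpf).divΛ_natural, ← t.2]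
    exact congrArg _ hb'

/-- **`B(p)` is injective** for the `ofDiagonalBase` engine when the `B₀`-transition along `F p` is injective (and `Φ(p)^gp` is,
§2). [cite: MochizukiFrdI2008, Def. 1.1(ii) p.19] -/
theorem ofDiagonalBase_pull_ratFnFunctor_injective {A₁ B₁ : D} (p : A₁ ⟶ B₁)
    (hB₀inj : Injective (dm.B₀.map (P.F.map p).op).hom) :
    Injective (pull (ofDiagonalBase hpf P hD hD' hFSM R S).ratFnFunctor p) := by
  intro t₁ t₂ h
  have h1 := congrArg (fun u : (ofDiagonalBase hpf P hD hD' hFSM R S).ratFn (op A₁) => u.1.1) h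
  have h2 := congrArg (fun u : (ofDiagonalBase hpf P hD hD' hFSM R S).ratFn (op A₁) => u.1.2) h
  refine Subtype.ext (Prod.ext (hB₀inj h1) ?_)
  have hinj := ofDiagonalBase_pullGp_divisorMonoid_injective hpf P hD hD' hFSM R S p
  exact hinj h2

end DescentEngine

end TemperedFrobenioid

end Literature.AnabelianGeometry.EtaleTheta

end
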